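import Literature.InformationTheory.QuantumCodes.TwoBlockTannerGraph
import Literature.InformationTheory.QuantumCodes.TwoBlockCosetDecomposition
import HarnessLib

/-!
# A disconnected two-block code is `[G : ⟨S⟩]` copies of the CONNECTED two-block code over `⟨S⟩`

Bravyi–Cross–Gambetta–Maslov–Rall–Yoder [BravyiEtAl2024, §5]: "The definition of code `QC(A,B)` does
not guarantee that its Tanner graph is connected. Some choices of `A` and `B` lead to a code that is
actually several separable code blocks … If `S` does not generate `M`, it necessarily generates a
subgroup `⟨S⟩` and nodes in connected components of the Tanner graph are labeled by elements of the
cosets of this subgroup" (Lemma 3: `ℓm/|⟨S⟩|` isomorphic components).  Lin–Pryadko [LinPryadko2024,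
§4.3, Statement 7] make the algebra explicit: the code "is decomposed into smaller mutually
disconnected subcodes", each "equivalent to … a 2BGA code over a subgroup".

This file COMPOSES three proved tree results into the parameter statement the qec census uses as its
scope word ("a disconnected row is a direct sum of copies of a connected code", CENSUS-PREREG P3.3″):
for every abelian two-block code `css a b` (`a ≠ 0`, `b ≠ 0`, any finite abelian `G`) with
`H = ⟨S⟩ = diffSubgroup a b` (`TwoBlockTannerGraph.lean`) and base points `s₀ ∈ supp a`, `t₀ ∈ supp b`,

* (s1) [`TwoBlockCodeEquivalences.lean`] translate: `css a b ≃ css a(· + s₀) b(· + t₀)`, after which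
  both supports lie in `H` (`mem_diffSubgroup_of_shift_ne_zero`);
* (s4) [`TwoBlockCosetDecomposition.lean`] decompose along the cosets of `H`;
* Lemma 3 [`TwoBlockTannerGraph.lean`]: the code over `H` on the restricted pair — the ROOT code
  `css (rootA a b s₀) (rootB a b t₀)` — has a CONNECTED Tanner graph (`root_tannerGraph_connected`,
  because its own `⟨S⟩` is all of `H`: `diffSubgroup_root_eq_top`).

Conclusions (`css_dX_eq_root`, `css_dZ_eq_root`, `css_k_eq_index_mul_root`, `card_qubits_eq_index_mul_root`,
packaged without base points in `exists_connected_root`):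

  `d_X(css a b) = d_X(root)`, `d_Z(css a b) = d_Z(root)`, `k(css a b) = [G:H] · k(root)`,
  `2|G| = [G:H] · 2|H|`, root connected, `#components(css a b) = [G:H]`.

The bivariate-bicycle phrasing (`G = ℤ_ℓ × ℤ_m`, exponent differences of the polynomials `A`, `B`) and
a unit-generator criterion used for the instances of [BravyiEtAl2024, Table 3] close the file
(`BB.Code.tannerGraph_connected_iff`, `BB.Code.tannerGraph_connected_of_unit_mem`).

## References (locators read on the page)
* [BravyiEtAl2024] Nature 627 (2024) 778 = arXiv:2308.07915, §5 Lemma 3 and the preceding paragraph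
  (held text chunk p0011 L7–19).
* [LinPryadko2024] H.-K. Lin, L. P. Pryadko, PRA 109 (2024) 022407 = arXiv:2306.16400, §4.3 and
  Statement 7 (chunk p0010 L1–55).

No named facts, no instances.
-/

namespace Literature.InformationTheory.QuantumCodes

namespace AbelianTwoBlock

open Matrix SimpleGraph

variable {G : Type*} [Fintype G] [AddCommGroup G]

/-! ### Translation invariance of `⟨S⟩`; supports of the re-based pair -/

omit [Fintype G] in
/-- The support differences are unchanged by independent translations of `a` and `b`.
[cite: BravyiEtAl2024, Lemma 3 (S consists of products A_iA_jᵀ, invariant under A ↦ αA; arXiv:2308.07915 chunk p0011 L10)] -/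
theorem diffSet_shift (a b : G → ZMod 2) (u v : G) : diffSet (shift u a) (shift v b) = diffSet a b := by
  ext d
  simp only [diffSet, Set.mem_union, Set.mem_setOf_eq, shift_apply]
  constructor
  · rintro (⟨s, s', hs, hs', rfl⟩ | ⟨t, t', ht, ht', rfl⟩)
    · exact Or.inl ⟨s - u, s' - u, hs, hs', by abel⟩
    · exact Or.inr ⟨t - v, t' - v, ht, ht', by abel⟩
  · rintro (⟨s, s', hs, hs', rfl⟩ | ⟨t, t', ht, ht', rfl⟩)
    · exact Or.inl ⟨s + u, s' + u, by simpa using hs, by simpa using hs', by abel⟩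
    · exact Or.inr ⟨t + v, t' + v, by simpa using ht, by simpa using ht', by abel⟩

omit [Fintype G] in
/-- `⟨S⟩` is unchanged by independent translations of `a` and `b`.
[cite: BravyiEtAl2024, Lemma 3 (arXiv:2308.07915 chunk p0011 L10)] -/
theorem diffSubgroup_shift (a b : G → ZMod 2) (u v : G) :
    diffSubgroup (shift u a) (shift v b) = diffSubgroup a b := by
  rw [diffSubgroup, diffSubgroup, diffSet_shift]

omit [Fintype G] in
/-- After re-basing at `s₀ ∈ supp a`, the support of `a(· + s₀)` lies in `⟨S⟩`.
[cite: BravyiEtAl2024, proof of Lemma 3 (arXiv:2308.07915 chunk p0011 L13–18)] -/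
theorem mem_diffSubgroup_of_shift_ne_zero {a b : G → ZMod 2} {s₀ : G} (hs₀ : a s₀ ≠ 0) {g : G}
    (hg : shift (-s₀) a g ≠ 0) : g ∈ diffSubgroup a b := by
  rw [shift_apply, sub_neg_eq_add] at hg
  simpa using sub_mem_diffSubgroup_left (b := b) hg hs₀

omit [Fintype G] in
/-- After re-basing at `t₀ ∈ supp b`, the support of `b(· + t₀)` lies in `⟨S⟩`.
[cite: BravyiEtAl2024, proof of Lemma 3 (arXiv:2308.07915 chunk p0011 L13–18)] -/
theorem mem_diffSubgroup_of_shift_ne_zero_right {a b : G → ZMod 2} {t₀ : G} (ht₀ : b t₀ ≠ 0) {g : G}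
    (hg : shift (-t₀) b g ≠ 0) : g ∈ diffSubgroup a b := by
  rw [shift_apply, sub_neg_eq_add] at hg
  simpa using sub_mem_diffSubgroup_right (a := a) hg ht₀

/-! ### The connected root code over `⟨S⟩` -/

/-- The first block of the ROOT code: `a(· + s₀)` restricted to `H = ⟨S⟩`.
[cite: LinPryadko2024, Statement 7 "a 2BGA code over a subgroup of G" (arXiv:2306.16400 chunk p0010 L47–55)] -/
def rootA (a b : G → ZMod 2) (s₀ : G) : ↥(diffSubgroup a b) → ZMod 2 :=
  restrict (diffSubgroup a b) (shift (-s₀) a)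

/-- The second block of the ROOT code: `b(· + t₀)` restricted to `H = ⟨S⟩`.
[cite: LinPryadko2024, Statement 7 (arXiv:2306.16400 chunk p0010 L47–55)] -/
def rootB (a b : G → ZMod 2) (t₀ : G) : ↥(diffSubgroup a b) → ZMod 2 :=
  restrict (diffSubgroup a b) (shift (-t₀) b)

omit [Fintype G] in
/-- `rootA a b s₀ h = a (h + s₀)`. [cite: LinPryadko2024, Statement 7 (arXiv:2306.16400 chunk p0010 L47–55)] -/
@[simp] theorem rootA_apply (a b : G → ZMod 2) (s₀ : G) (h : ↥(diffSubgroup a b)) :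
    rootA a b s₀ h = a (h + s₀) := by
  simp [rootA, sub_neg_eq_add]

omit [Fintype G] in
/-- `rootB a b t₀ h = b (h + t₀)`. [cite: LinPryadko2024, Statement 7 (arXiv:2306.16400 chunk p0010 L47–55)] -/
@[simp] theorem rootB_apply (a b : G → ZMod 2) (t₀ : G) (h : ↥(diffSubgroup a b)) :
    rootB a b t₀ h = b (h + t₀) := by
  simp [rootB, sub_neg_eq_add]

section Root

variable {a b : G → ZMod 2} [DecidablePred (· ∈ diffSubgroup a b)] {s₀ t₀ : G}
  (hs₀ : a s₀ ≠ 0) (ht₀ : b t₀ ≠ 0)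
include hs₀ ht₀

/-- **`d_X` of a two-block code is the `d_X` of its connected root code.**
[cite: BravyiEtAl2024, §5 "a code that is actually several separable code blocks" + Lemma 3 (arXiv:2308.07915 chunk p0011 L7–10)]
[cite: LinPryadko2024, §4.3 / Statement 7 (arXiv:2306.16400 chunk p0010 L1–55)] -/
theorem css_dX_eq_root : (css a b).dX = (css (rootA a b s₀) (rootB a b t₀)).dX := by
  classical
  rw [← css_shift_dX a b (-s₀) (-t₀)]
  exact css_dX_eq_restrict (diffSubgroup a b)
    (fun g hg => not_not.mp fun h => hg (mem_diffSubgroup_of_shift_ne_zero hs₀ h))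
    (fun g hg => not_not.mp fun h => hg (mem_diffSubgroup_of_shift_ne_zero_right ht₀ h))

/-- **`d_Z` of a two-block code is the `d_Z` of its connected root code.**
[cite: BravyiEtAl2024, §5 + Lemma 3 (arXiv:2308.07915 chunk p0011 L7–10)]
[cite: LinPryadko2024, §4.3 / Statement 7 (arXiv:2306.16400 chunk p0010 L1–55)] -/
theorem css_dZ_eq_root : (css a b).dZ = (css (rootA a b s₀) (rootB a b t₀)).dZ := by
  classical
  rw [← css_shift_dZ a b (-s₀) (-t₀)]
  exact css_dZ_eq_restrict (diffSubgroup a b)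
    (fun g hg => not_not.mp fun h => hg (mem_diffSubgroup_of_shift_ne_zero hs₀ h))
    (fun g hg => not_not.mp fun h => hg (mem_diffSubgroup_of_shift_ne_zero_right ht₀ h))

/-- **`k` of a two-block code is `[G : ⟨S⟩]` times the `k` of its connected root code** (one copy per
connected component). [cite: BravyiEtAl2024, Lemma 3 "ℓm/|⟨S⟩|" components (arXiv:2308.07915 chunk p0011 L10)]
[cite: LinPryadko2024, §4.3 (direct sum of the coset subcodes) (arXiv:2306.16400 chunk p0010 L34–36)] -/
theorem css_k_eq_index_mul_root :
    (css a b).k = (diffSubgroup a b).index * (css (rootA a b s₀) (rootB a b t₀)).k := by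
  classical
  rw [← css_shift_k a b (-s₀) (-t₀)]
  exact css_k_eq_index_mul (diffSubgroup a b)
    (fun g hg => not_not.mp fun h => hg (mem_diffSubgroup_of_shift_ne_zero hs₀ h))
    (fun g hg => not_not.mp fun h => hg (mem_diffSubgroup_of_shift_ne_zero_right ht₀ h))

omit hs₀ ht₀ in
/-- The qubit count splits accordingly: `2|G| = [G:⟨S⟩] · 2|⟨S⟩|`.
[cite: BravyiEtAl2024, Lemma 3 (arXiv:2308.07915 chunk p0011 L10)] -/
theorem card_qubits_eq_index_mul_root :
    Fintype.card (G ⊕ G) =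
      (diffSubgroup a b).index * Fintype.card (↥(diffSubgroup a b) ⊕ ↥(diffSubgroup a b)) := by
  classical
  exact card_qubits_eq_index_mul (diffSubgroup a b)

omit [Fintype G] [DecidablePred (· ∈ diffSubgroup a b)] ht₀ in
/-- The root code's first block is non-zero (`rootA 0 = a s₀ ≠ 0`). [cite: BravyiEtAl2024, Lemma 3 (arXiv:2308.07915 chunk p0011 L10)] -/
theorem rootA_ne_zero : rootA a b s₀ ≠ 0 :=
  Function.ne_iff.mpr ⟨⟨0, zero_mem _⟩, by simpa using hs₀⟩

omit [Fintype G] [DecidablePred (· ∈ diffSubgroup a b)] hs₀ in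
/-- The root code's second block is non-zero. [cite: BravyiEtAl2024, Lemma 3 (arXiv:2308.07915 chunk p0011 L10)] -/
theorem rootB_ne_zero : rootB a b t₀ ≠ 0 :=
  Function.ne_iff.mpr ⟨⟨0, zero_mem _⟩, by simpa using ht₀⟩

omit [Fintype G] [DecidablePred (· ∈ diffSubgroup a b)] in
/-- The support differences of the root code, read in `G`, are exactly those of the re-based pair.
[cite: BravyiEtAl2024, proof of Lemma 3 (arXiv:2308.07915 chunk p0011 L13–18)] -/
theorem subtype_image_diffSet_root :
    (diffSubgroup a b).subtype '' diffSet (rootA a b s₀) (rootB a b t₀) =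
      diffSet (shift (-s₀) a) (shift (-t₀) b) := by
  ext d
  simp only [Set.mem_image, diffSet, Set.mem_union, Set.mem_setOf_eq, rootA_apply, rootB_apply,
    shift_apply, sub_neg_eq_add, AddSubgroup.coe_subtype]
  constructor
  · rintro ⟨x, (⟨s, s', hs, hs', rfl⟩ | ⟨t, t', ht, ht', rfl⟩), rfl⟩
    · exact Or.inl ⟨s, s', hs, hs', by simp⟩
    · exact Or.inr ⟨t, t', ht, ht', by simp⟩
  · rintro (⟨s, s', hs, hs', rfl⟩ | ⟨t, t', ht, ht', rfl⟩)
    · have hsH : s ∈ diffSubgroup a b :=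
        mem_diffSubgroup_of_shift_ne_zero (b := b) hs₀ (by simpa [sub_neg_eq_add] using hs)
      have hs'H : s' ∈ diffSubgroup a b :=
        mem_diffSubgroup_of_shift_ne_zero (b := b) hs₀ (by simpa [sub_neg_eq_add] using hs')
      exact ⟨⟨s, hsH⟩ - ⟨s', hs'H⟩, Or.inl ⟨⟨s, hsH⟩, ⟨s', hs'H⟩, hs, hs', rfl⟩, by simp⟩
    · have htH : t ∈ diffSubgroup a b :=
        mem_diffSubgroup_of_shift_ne_zero_right (a := a) ht₀ (by simpa [sub_neg_eq_add] using ht)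
      have ht'H : t' ∈ diffSubgroup a b :=
        mem_diffSubgroup_of_shift_ne_zero_right (a := a) ht₀ (by simpa [sub_neg_eq_add] using ht')
      exact ⟨⟨t, htH⟩ - ⟨t', ht'H⟩, Or.inr ⟨⟨t, htH⟩, ⟨t', ht'H⟩, ht, ht', rfl⟩, by simp⟩

omit [Fintype G] [DecidablePred (· ∈ diffSubgroup a b)] in
/-- **The root code's support differences generate all of `⟨S⟩`.**
[cite: BravyiEtAl2024, Lemma 3 (arXiv:2308.07915 chunk p0011 L10–18)] -/
theorem diffSubgroup_root_eq_top : diffSubgroup (rootA a b s₀) (rootB a b t₀) = ⊤ := by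
  apply AddSubgroup.map_injective (diffSubgroup a b).subtype_injective
  have h1 : AddSubgroup.map (diffSubgroup a b).subtype (diffSubgroup (rootA a b s₀) (rootB a b t₀)) =
      diffSubgroup a b := by
    show AddSubgroup.map _ (AddSubgroup.closure _) = _
    rw [AddMonoidHom.map_closure, subtype_image_diffSet_root hs₀ ht₀]
    exact diffSubgroup_shift a b (-s₀) (-t₀)
  have h2 : AddSubgroup.map (diffSubgroup a b).subtype ⊤ = diffSubgroup a b := by
    rw [← AddMonoidHom.range_eq_map, AddSubgroup.range_subtype]
  rw [h1, h2]

/-- **The root code has a connected Tanner graph.**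
[cite: BravyiEtAl2024, Lemma 3 (arXiv:2308.07915 chunk p0011 L9–10)] -/
theorem root_tannerGraph_connected : (css (rootA a b s₀) (rootB a b t₀)).tannerGraph.Connected :=
  (tannerGraph_connected_iff (rootA_ne_zero hs₀) (rootB_ne_zero ht₀)).mpr
    (diffSubgroup_root_eq_top hs₀ ht₀)

end Root

/-- **Connected normal form of an abelian two-block code** (base-point free packaging): for `a ≠ 0`,
`b ≠ 0` there is a two-block code over `H = ⟨S⟩` with CONNECTED Tanner graph whose `d_X`, `d_Z` are those
of `css a b` and whose `k` is `k(css a b)/[G:H]`; `css a b` has `[G:H]` connected components.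
[cite: BravyiEtAl2024, §5 and Lemma 3 (arXiv:2308.07915 chunk p0011 L7–19)]
[cite: LinPryadko2024, §4.3 / Statement 7 (arXiv:2306.16400 chunk p0010 L1–55)] -/
theorem exists_connected_root {a b : G → ZMod 2} [DecidablePred (· ∈ diffSubgroup a b)]
    (ha : a ≠ 0) (hb : b ≠ 0) :
    ∃ a' b' : ↥(diffSubgroup a b) → ZMod 2,
      (css a' b').tannerGraph.Connected ∧
      (css a b).dX = (css a' b').dX ∧ (css a b).dZ = (css a' b').dZ ∧
      (css a b).k = (diffSubgroup a b).index * (css a' b').k ∧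
      Nat.card (css a b).tannerGraph.ConnectedComponent = (diffSubgroup a b).index := by
  obtain ⟨s₀, hs₀⟩ : ∃ s, a s ≠ 0 := Function.ne_iff.mp ha
  obtain ⟨t₀, ht₀⟩ : ∃ t, b t ≠ 0 := Function.ne_iff.mp hb
  exact ⟨rootA a b s₀, rootB a b t₀, root_tannerGraph_connected hs₀ ht₀, css_dX_eq_root hs₀ ht₀,
    css_dZ_eq_root hs₀ ht₀, css_k_eq_index_mul_root hs₀ ht₀, card_connectedComponent_eq_index ha hb⟩

end AbelianTwoBlock

/-! ### Bivariate-bicycle phrasing (`G = ℤ_ℓ × ℤ_m`) -/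

namespace BB.Code

open AbelianTwoBlock

variable {ℓ m : ℕ} [NeZero ℓ] [NeZero m] (C : Code ℓ m)

/-- The printed `S` of `QC(A,B)` in exponent notation: differences of two exponents of `A`, and of two
exponents of `B` (`A_iA_jᵀ = x^{α_i − α_j} y^{β_i − β_j}`), and `⟨S⟩ ≤ ℤ_ℓ × ℤ_m`.
[cite: BravyiEtAl2024, Lemma 3 "S = {A_iA_j^T} ∪ {B_iB_j^T}" (arXiv:2308.07915 chunk p0011 L10)] -/
def expDiffSubgroup : AddSubgroup (Mono ℓ m) :=
  AddSubgroup.closure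
    ({d | ∃ g g', C.A g ≠ 0 ∧ C.A g' ≠ 0 ∧ d = g - g'} ∪ {d | ∃ g g', C.B g ≠ 0 ∧ C.B g' ≠ 0 ∧ d = g - g'})

/-- The abstract `⟨S⟩` of the coefficient vectors is the exponent-difference subgroup of the polynomials
(`coeffVec p g = p (−g)` only swaps the roles of the two exponents).
[cite: BravyiEtAl2024, Lemma 3 (arXiv:2308.07915 chunk p0011 L10)] -/
theorem diffSubgroup_coeffVec : diffSubgroup (coeffVec C.A) (coeffVec C.B) = C.expDiffSubgroup := by
  rw [diffSubgroup, expDiffSubgroup]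
  congr 1
  ext d
  simp only [diffSet, Set.mem_union, Set.mem_setOf_eq, coeffVec_apply]
  constructor
  · rintro (⟨s, s', hs, hs', rfl⟩ | ⟨t, t', ht, ht', rfl⟩)
    · exact Or.inl ⟨-s', -s, hs', hs, by abel⟩
    · exact Or.inr ⟨-t', -t, ht', ht, by abel⟩
  · rintro (⟨g, g', hg, hg', rfl⟩ | ⟨g, g', hg, hg', rfl⟩)
    · exact Or.inl ⟨-g', -g, by simpa using hg', by simpa using hg, by abel⟩
    · exact Or.inr ⟨-g', -g, by simpa using hg', by simpa using hg, by abel⟩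

/-- **Lemma 3 (i) for `QC(A,B)`**: for `A ≠ 0`, `B ≠ 0` the Tanner graph is connected iff the exponent
differences generate `ℤ_ℓ × ℤ_m`. [cite: BravyiEtAl2024, Lemma 3 (arXiv:2308.07915 chunk p0011 L9–10)] -/
theorem tannerGraph_connected_iff (hA : C.A ≠ 0) (hB : C.B ≠ 0) :
    C.css.tannerGraph.Connected ↔ C.expDiffSubgroup = ⊤ := by
  have hA' : coeffVec C.A ≠ 0 := fun h => hA (funext fun g => by simpa using congrFun h (-g))
  have hB' : coeffVec C.B ≠ 0 := fun h => hB (funext fun g => by simpa using congrFun h (-g))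
  rw [css_eq, AbelianTwoBlock.tannerGraph_connected_iff hA' hB', diffSubgroup_coeffVec]

/-- **Lemma 3 (ii) for `QC(A,B)`**, printed form: `#components · |⟨S⟩| = ℓm`.
[cite: BravyiEtAl2024, Lemma 3 "The number of connected components in the Tanner graph is ℓm/|⟨S⟩|" (arXiv:2308.07915 chunk p0011 L10)] -/
theorem card_connectedComponent_mul_card (hA : C.A ≠ 0) (hB : C.B ≠ 0) :
    Nat.card C.css.tannerGraph.ConnectedComponent * Nat.card C.expDiffSubgroup = ℓ * m := by
  have hA' : coeffVec C.A ≠ 0 := fun h => hA (funext fun g => by simpa using congrFun h (-g))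
  have hB' : coeffVec C.B ≠ 0 := fun h => hB (funext fun g => by simpa using congrFun h (-g))
  rw [css_eq, ← diffSubgroup_coeffVec, AbelianTwoBlock.card_connectedComponent_mul_card hA' hB',
    Nat.card_eq_fintype_card, Fintype.card_prod, Fintype.card_fin, Fintype.card_fin]

/-- If `x = (1,0)` and `y = (0,1)` are in a subgroup of `M = ℤ_ℓ × ℤ_m`, it is all of `M` (every
monomial `xⁱyʲ` is a product of powers of `x` and `y`).
[cite: BravyiEtAl2024, §5 "M = {1, y, …, y^{m−1}, x, xy, …, xy^{m−1}, …, x^{ℓ−1}y^{m−1}}" (arXiv:2308.07915 chunk p0010 L47)] -/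
theorem addSubgroup_eq_top_of_unit_mem (K : AddSubgroup (Mono ℓ m)) (hx : ((1 : Fin ℓ), (0 : Fin m)) ∈ K)
    (hy : ((0 : Fin ℓ), (1 : Fin m)) ∈ K) : K = ⊤ := by
  have h1 : ∀ n : ℕ, (Fin.ofNat ℓ n, (0 : Fin m)) ∈ K := by
    intro n
    induction n with
    | zero => exact K.zero_mem
    | succ n ih =>
      have e : (Fin.ofNat ℓ (n + 1), (0 : Fin m)) = (Fin.ofNat ℓ n, (0 : Fin m)) + ((1 : Fin ℓ), (0 : Fin m)) := by
        ext <;> simp [Fin.val_add, Nat.add_mod]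
      rw [e]; exact K.add_mem ih hx
  have h2 : ∀ n : ℕ, ((0 : Fin ℓ), Fin.ofNat m n) ∈ K := by
    intro n
    induction n with
    | zero => exact K.zero_mem
    | succ n ih =>
      have e : ((0 : Fin ℓ), Fin.ofNat m (n + 1)) = ((0 : Fin ℓ), Fin.ofNat m n) + ((0 : Fin ℓ), (1 : Fin m)) := by
        ext <;> simp [Fin.val_add, Nat.add_mod]
      rw [e]; exact K.add_mem ih hy
  rw [AddSubgroup.eq_top_iff']
  rintro ⟨i, j⟩
  have e : ((i, j) : Mono ℓ m) = (Fin.ofNat ℓ i.val, (0 : Fin m)) + ((0 : Fin ℓ), Fin.ofNat m j.val) := by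
    ext <;> simp
  rw [e]; exact K.add_mem (h1 _) (h2 _)

/-- **Connectivity test used for the instances**: if `A ≠ 0`, `B ≠ 0` and the unit exponents `x = (1,0)`,
`y = (0,1)` are generated by the exponent differences, `QC(A,B)` has a connected Tanner graph.
[cite: BravyiEtAl2024, Lemma 3 (arXiv:2308.07915 chunk p0011 L9–10)] -/
theorem tannerGraph_connected_of_unit_mem (hA : C.A ≠ 0) (hB : C.B ≠ 0)
    (hx : ((1 : Fin ℓ), (0 : Fin m)) ∈ C.expDiffSubgroup) (hy : ((0 : Fin ℓ), (1 : Fin m)) ∈ C.expDiffSubgroup) :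
    C.css.tannerGraph.Connected :=
  (C.tannerGraph_connected_iff hA hB).mpr (addSubgroup_eq_top_of_unit_mem _ hx hy)

/-- Exponent differences of `A` lie in `⟨S⟩`. [cite: BravyiEtAl2024, Lemma 3 (arXiv:2308.07915 chunk p0011 L10)] -/
theorem sub_mem_expDiffSubgroup_A {g g' : Mono ℓ m} (hg : C.A g ≠ 0) (hg' : C.A g' ≠ 0) :
    g - g' ∈ C.expDiffSubgroup :=
  AddSubgroup.subset_closure (Or.inl ⟨g, g', hg, hg', rfl⟩)

/-- Exponent differences of `B` lie in `⟨S⟩`. [cite: BravyiEtAl2024, Lemma 3 (arXiv:2308.07915 chunk p0011 L10)] -/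
theorem sub_mem_expDiffSubgroup_B {g g' : Mono ℓ m} (hg : C.B g ≠ 0) (hg' : C.B g' ≠ 0) :
    g - g' ∈ C.expDiffSubgroup :=
  AddSubgroup.subset_closure (Or.inr ⟨g, g', hg, hg', rfl⟩)

end BB.Code

end Literature.InformationTheory.QuantumCodes
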